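import Summits.AtomisticToContinuum.Crystallization.Theorems.OverbindingBudgetAffineCompressedCutRun

/-!
# Overbinding budget — compressed cut: R4 «LR(r₁)» II — OFF-CENTRE BASE GROWTH (the seed need not be the disc centre)

Record: route `OverbindingBudget`, crux `RobustDefectLimitWindows` (stmt-AtomisticToContinuum-31280); open leaf NS♭₂ ⟸ 79K ⟸ LR(r₁);
R4 «LR(r₁)», obligation (O-A) of memo NODE-g81-Run §3.  In Case A of memo g80 §2 the seed `k₀` (the nearest hcp site, `≤ 6` bonds from `i`) is NOT
the centre of the base disc that the stack run needs (the disc about `i`'s column): a disc CENTRED at `k₀` and large enough would leave the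
`12·nn_i` ball.  This file grows a layer disc about an ARBITRARY centre label `q₀` from a seed anywhere inside it.

WHAT THIS FILE PROVES (potential-free, sorry-free; pure `T3` arithmetic + R2's one-parent step).
* §1 hex-ball arithmetic: `two_abs_le_lnorm`, `abs_le_of_lnorm_le`, `lnorm_le_of_abs_le` (on the layer plane `lnorm = 2·max |coordinate|`),
  `coord_step_down` / `coord_step_up` (the sign lemma: a distance-reducing basal step moves a coordinate `≥ 3` down / `≤ −3` up), `lnorm_tsub_le`,
  ★ `ball_descent`: for layer points `x ≠ s` of the hex ball of radius `n` there is a basal step `h ∈ hexL` that reduces the hex distance to `s` by one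
  AND STAYS IN THE BALL.
* §2 ★★ `layer_disc_off` — R2's `…Seed.layer_disc` with the seed OFF CENTRE: ball data at base `i`; copy `C ⊇ hexL` with one-parent tables forced to `C`;
  a seed `j₀` established at label `q₀ + x₀` (`x₀` a layer vector of the ball); monotone bound sequences obeying R2's two step inequalities below `dm`;
  ROOM on the whole ball.  Conclusion: every layer point `q₀ + x` of the ball at hex distance `d ≤ dm` from the seed is the label of an established
  site charted onto `C` with bounds `(τs d, Ds d)` and scale in `[0.9967^d, 1.0011^d]·nn_{j₀}`.  `layer_disc_off_all`: the uniform version over the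
  whole ball (`12n… ≤ 6·dm`).
* §3 `layer_disc_off_hcp` — record instance: the seed carries `H` or `H′` (E1 rows `e1_entries`), any base frame `B`, any centre.

Deps: `…CompressedCutRun`.  No `instance`, no `notation`, no `set_option`, no new axioms, 0 sorry.
-/

namespace Summit.AtomisticToContinuum.Crystallization.Theorems.OverbindingBudgetAffineCompressedCutOffDisc

open Literature.Geometry.DiscreteGeometry (nearestDist nearestDist_nonneg fccTwoShellPattern hcpTwoShellPattern)
open Summit.AtomisticToContinuum.Crystallization.Theorems.OverbindingBudgetAffineCompressedCutKernel (T3 tsub tadd tsq thsum fccL hcpL fccNegL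
  hcpAltL hexL kernelOneB e1_entries)
open Summit.AtomisticToContinuum.Crystallization.Theorems.OverbindingBudgetAffineCompressedCutCharts (mv)
open Summit.AtomisticToContinuum.Crystallization.Theorems.OverbindingBudgetAffineCompressedCutEstablish (Estab estab_child_one)
open Summit.AtomisticToContinuum.Crystallization.Theorems.OverbindingBudgetAffineCompressedCutSeed (InLayer lnorm hexL_facts hex_descent estab_mono
  inLayer_tsub tadd_tadd_tsub hexL_sub)

variable {N : ℕ}

/-! ## §1  Hex-ball arithmetic -/

/-- On the layer plane each coordinate is at most half the `ℓ¹` size. [this file] -/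
theorem two_abs_le_lnorm {u : T3} (hu : u.1 + u.2.1 + u.2.2 = 0) : 2 * |u.1| ≤ lnorm u ∧ 2 * |u.2.1| ≤ lnorm u ∧ 2 * |u.2.2| ≤ lnorm u := by
  obtain ⟨a, b, c⟩ := u
  simp only [lnorm] at hu ⊢
  have ha : a = -(b + c) := by omega
  have hb : b = -(a + c) := by omega
  have hc : c = -(a + b) := by omega
  refine ⟨?_, ?_, ?_⟩
  · have h : |a| ≤ |b| + |c| := by rw [ha, abs_neg]; exact abs_add_le b c
    linarith
  · have h : |b| ≤ |a| + |c| := by rw [hb, abs_neg]; exact abs_add_le a c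
    linarith
  · have h : |c| ≤ |a| + |b| := by rw [hc, abs_neg]; exact abs_add_le a b
    linarith

/-- Coordinates of a layer point of the hex ball of radius `n` are bounded by `3n`. [this file] -/
theorem abs_le_of_lnorm_le {u : T3} {n : ℤ} (hu : u.1 + u.2.1 + u.2.2 = 0) (h : lnorm u ≤ 6 * n) :
    |u.1| ≤ 3 * n ∧ |u.2.1| ≤ 3 * n ∧ |u.2.2| ≤ 3 * n := by
  obtain ⟨h1, h2, h3⟩ := two_abs_le_lnorm hu
  exact ⟨by linarith, by linarith, by linarith⟩

/-- Conversely, coordinate bounds `3n` give `lnorm ≤ 6n` on the layer plane (`lnorm = 2·max`). [this file] -/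
theorem lnorm_le_of_abs_le {u : T3} {n : ℤ} (hu : u.1 + u.2.1 + u.2.2 = 0) (h1 : |u.1| ≤ 3 * n) (h2 : |u.2.1| ≤ 3 * n) (h3 : |u.2.2| ≤ 3 * n) :
    lnorm u ≤ 6 * n := by
  obtain ⟨a, b, c⟩ := u
  simp only [lnorm] at hu h1 h2 h3 ⊢
  rw [abs_le] at h1 h2 h3
  rcases abs_cases a with ⟨ea, _⟩ | ⟨ea, _⟩ <;> rcases abs_cases b with ⟨eb, _⟩ | ⟨eb, _⟩ <;>
    rcases abs_cases c with ⟨ec, _⟩ | ⟨ec, _⟩ <;> rw [ea, eb, ec] <;> omega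

/-- Sign lemma (down): if removing `3` from the coordinate `x − s` is length-neutral up to `3` (`|x − s − 3| = |x − s| − 3`) then `x − s ≥ 3`, hence
`|x − 3| ≤ 3n` whenever `|s| ≤ 3n` and `|x| ≤ 3n`. [this file] -/
theorem coord_step_down {x s n : ℤ} (h : |x - s - 3| = |x - s| - 3) (hs : |s| ≤ 3 * n) (hx : |x| ≤ 3 * n) : |x - 3| ≤ 3 * n := by
  have hz : 3 ≤ x - s := by
    by_contra hlt
    rw [abs_of_nonpos (by linarith : x - s - 3 ≤ 0)] at h
    rcases abs_cases (x - s) with ⟨e, _⟩ | ⟨e, _⟩ <;> rw [e] at h <;> linarith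
  rw [abs_le] at hs hx ⊢
  constructor <;> linarith

/-- Sign lemma (up): `|x − s + 3| = |x − s| − 3` forces `x − s ≤ −3`, hence `|x + 3| ≤ 3n`. [this file] -/
theorem coord_step_up {x s n : ℤ} (h : |x - s + 3| = |x - s| - 3) (hs : |s| ≤ 3 * n) (hx : |x| ≤ 3 * n) : |x + 3| ≤ 3 * n := by
  have hz : x - s ≤ -3 := by
    by_contra hlt
    rw [abs_of_nonneg (by linarith : 0 ≤ x - s + 3)] at h
    rcases abs_cases (x - s) with ⟨e, _⟩ | ⟨e, _⟩ <;> rw [e] at h <;> linarith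
  rw [abs_le] at hs hx ⊢
  constructor <;> linarith

/-- `lnorm (x − x₀) ≤ lnorm x + lnorm x₀`. [this file] -/
theorem lnorm_tsub_le (x x₀ : T3) : lnorm (tsub x x₀) ≤ lnorm x + lnorm x₀ := by
  obtain ⟨a, b, c⟩ := x
  obtain ⟨d, e, g⟩ := x₀
  simp only [lnorm, tsub]
  linarith [abs_sub a d, abs_sub b e, abs_sub c g]

/-- `(x − h) − s = (x − s) − h`. [this file] -/
theorem tsub_tsub_comm (x h s : T3) : tsub (tsub x h) s = tsub (tsub x s) h := by
  obtain ⟨a, b, c⟩ := x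
  obtain ⟨d, e, g⟩ := h
  obtain ⟨p, q, u⟩ := s
  simp only [tsub, Prod.mk.injEq]
  omega

/-- The two general triangle facts used to read off the sign pattern of a descent step. [this file] -/
theorem abs_step_facts (z : ℤ) : |z| - 3 ≤ |z - 3| ∧ |z| - 3 ≤ |z + 3| := by
  constructor
  · have h := abs_sub_abs_le_abs_sub z 3
    have h3 : |(3 : ℤ)| = 3 := by norm_num
    rw [h3] at h
    exact h
  · have h := abs_sub_abs_le_abs_sub z (-3)
    have h3 : |(-3 : ℤ)| = 3 := by norm_num
    rw [h3, sub_neg_eq_add] at h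
    exact h

/-- ★ **BALL DESCENT.**  In the hex ball of radius `n` (layer vectors of `lnorm ≤ 6n`), every layer point `x ≠ s` admits a basal step `h ∈ hexL` reducing
the hex distance to `s` by one and staying inside the ball. [this file] -/
theorem ball_descent {x s : T3} {n : ℤ} (hx : InLayer x) (hs : InLayer s) (hne : x ≠ s) (hxb : lnorm x ≤ 6 * n) (hsb : lnorm s ≤ 6 * n) :
    ∃ h ∈ hexL, lnorm (tsub (tsub x h) s) + 6 = lnorm (tsub x s) ∧ lnorm (tsub x h) ≤ 6 * n := by
  have hz : InLayer (tsub x s) := inLayer_tsub hx hs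
  have hz0 : tsub x s ≠ (0, 0, 0) := by
    intro h0
    apply hne
    obtain ⟨a, b, c⟩ := x
    obtain ⟨p, q, u⟩ := s
    simp only [tsub, Prod.mk.injEq] at h0 ⊢
    omega
  obtain ⟨h, hh, hdesc⟩ := hex_descent hz hz0
  refine ⟨h, hh, by rw [tsub_tsub_comm]; exact hdesc, ?_⟩
  obtain ⟨bx1, bx2, bx3⟩ := abs_le_of_lnorm_le hx.1 hxb
  obtain ⟨bs1, bs2, bs3⟩ := abs_le_of_lnorm_le hs.1 hsb
  clear hz hz0 hxb hsb hne hs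
  obtain ⟨a, b, c⟩ := x
  obtain ⟨p, q, u⟩ := s
  obtain ⟨hxs, -, -⟩ := hx
  dsimp only at bx1 bx2 bx3 bs1 bs2 bs3 hxs
  obtain ⟨fa1, fa2⟩ := abs_step_facts (a - p)
  obtain ⟨fb1, fb2⟩ := abs_step_facts (b - q)
  obtain ⟨fc1, fc2⟩ := abs_step_facts (c - u)
  simp only [hexL, List.mem_cons, List.not_mem_nil, or_false] at hh
  rcases hh with rfl | rfl | rfl | rfl | rfl | rfl <;> simp only [lnorm, tsub, sub_zero, sub_neg_eq_add] at hdesc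
  · -- h = (3, 0, −3): a down, c up
    have e1 : |a - p - 3| = |a - p| - 3 := by linarith
    have e2 : |c - u + 3| = |c - u| - 3 := by linarith
    have e : tsub (a, b, c) (3, 0, -3) = (a - 3, b, c + 3) := by
      simp only [tsub, sub_zero, sub_neg_eq_add]
    rw [e]
    exact lnorm_le_of_abs_le (by show a - 3 + b + (c + 3) = 0; omega) (coord_step_down e1 bs1 bx1) bx2 (coord_step_up e2 bs3 bx3)
  · -- h = (3, −3, 0): a down, b up
    have e1 : |a - p - 3| = |a - p| - 3 := by linarith
    have e2 : |b - q + 3| = |b - q| - 3 := by linarith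
    have e : tsub (a, b, c) (3, -3, 0) = (a - 3, b + 3, c) := by
      simp only [tsub, sub_zero, sub_neg_eq_add]
    rw [e]
    exact lnorm_le_of_abs_le (by show a - 3 + (b + 3) + c = 0; omega) (coord_step_down e1 bs1 bx1) (coord_step_up e2 bs2 bx2) bx3
  · -- h = (0, 3, −3): b down, c up
    have e1 : |b - q - 3| = |b - q| - 3 := by linarith
    have e2 : |c - u + 3| = |c - u| - 3 := by linarith
    have e : tsub (a, b, c) (0, 3, -3) = (a, b - 3, c + 3) := by
      simp only [tsub, sub_zero, sub_neg_eq_add]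
    rw [e]
    exact lnorm_le_of_abs_le (by show a + (b - 3) + (c + 3) = 0; omega) bx1 (coord_step_down e1 bs2 bx2) (coord_step_up e2 bs3 bx3)
  · -- h = (0, −3, 3): b up, c down
    have e1 : |b - q + 3| = |b - q| - 3 := by linarith
    have e2 : |c - u - 3| = |c - u| - 3 := by linarith
    have e : tsub (a, b, c) (0, -3, 3) = (a, b + 3, c - 3) := by
      simp only [tsub, sub_zero, sub_neg_eq_add]
    rw [e]
    exact lnorm_le_of_abs_le (by show a + (b + 3) + (c - 3) = 0; omega) bx1 (coord_step_up e1 bs2 bx2) (coord_step_down e2 bs3 bx3)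
  · -- h = (−3, 3, 0): a up, b down
    have e1 : |a - p + 3| = |a - p| - 3 := by linarith
    have e2 : |b - q - 3| = |b - q| - 3 := by linarith
    have e : tsub (a, b, c) (-3, 3, 0) = (a + 3, b - 3, c) := by
      simp only [tsub, sub_zero, sub_neg_eq_add]
    rw [e]
    exact lnorm_le_of_abs_le (by show a + 3 + (b - 3) + c = 0; omega) (coord_step_up e1 bs1 bx1) (coord_step_down e2 bs2 bx2) bx3
  · -- h = (−3, 0, 3): a up, c down
    have e1 : |a - p + 3| = |a - p| - 3 := by linarith
    have e2 : |c - u - 3| = |c - u| - 3 := by linarith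
    have e : tsub (a, b, c) (-3, 0, 3) = (a + 3, b, c - 3) := by
      simp only [tsub, sub_zero, sub_neg_eq_add]
    rw [e]
    exact lnorm_le_of_abs_le (by show a + 3 + b + (c - 3) = 0; omega) (coord_step_up e1 bs1 bx1) bx2 (coord_step_down e2 bs3 bx3)

/-! ## §2  The off-centre layer disc -/

/-- ★★ **OFF-CENTRE LAYER DISC.**  R2's `…Seed.layer_disc` with the seed anywhere in the disc.  Hypotheses: ball data at base `i` (radius `r`); a copy
`C ⊇ hexL`, offsets `xs ⊇ hexL`, one-parent tables (members of length `≤ 18`) whose outputs are forced to `C` on the ball; a CENTRE LABEL `q₀` and a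
SEED OFFSET `x₀` (a layer vector of the hex ball of radius `n`) with an established seed `j₀` at label `q₀ + x₀` (bounds `τs 0, Ds 0`); monotone bound
sequences obeying the two step inequalities below `dm`; room on the whole ball with `Ds dm`.  Conclusion: every layer point `q₀ + x` of the ball at hex
distance `≤ d ≤ dm` from the seed is the label of an established `C`-charted site with bounds `(τs d, Ds d)` and scale in
`[0.9967^d, 1.0011^d]·nn_{j₀}`.  Proof: induction on `d` through `ball_descent` (the descent stays in the ball) and `estab_child_one`. [this file] -/
theorem layer_disc_off {y : Fin N → EuclideanSpace ℝ (Fin 3)} (hy : Function.Injective y) {r : ℝ} {i : Fin N}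
    {A : Fin N → (EuclideanSpace ℝ (Fin 3) →ₗ[ℝ] EuclideanSpace ℝ (Fin 3))} {Qf : Fin N → (EuclideanSpace ℝ (Fin 3) →ₗᵢ[ℝ] EuclideanSpace ℝ (Fin 3))}
    {P : Fin N → Finset (EuclideanSpace ℝ (Fin 3))} {f : Fin N → EuclideanSpace ℝ (Fin 3) → EuclideanSpace ℝ (Fin 3)}
    {B : EuclideanSpace ℝ (Fin 3) →ₗ[ℝ] EuclideanSpace ℝ (Fin 3)}
    (hP : ∀ j, dist (y j) (y i) ≤ r → (P j = fccTwoShellPattern ∨ P j = hcpTwoShellPattern))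
    (hA : ∀ j, dist (y j) (y i) ≤ r → ∀ v ∈ P j, ‖A j v - Qf j v‖ ≤ 1 / 1000)
    (hf : ∀ j, dist (y j) (y i) ≤ r → ∀ v ∈ P j, f j v ∈ Set.range y ∧ dist (f j v) (y j + nearestDist y j • A j v) ≤ 1 / 10 ^ 4 * nearestDist y j)
    (hinj : ∀ j, dist (y j) (y i) ≤ r → Set.InjOn (f j) ↑(P j))
    (hex : ∀ j, dist (y j) (y i) ≤ r → ∀ m, m ≠ j → dist (y m) (y j) ≤ (3 / 2 + 1 / 450) * nearestDist y j → ∃ v ∈ P j, f j v = y m)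
    {C xs : List T3} {Qsf Qsh : List (List T3)} (hKf : kernelOneB C xs fccL Qsf = true) (hKh : kernelOneB C xs hcpL Qsh = true)
    (hlf : ∀ Q ∈ Qsf, Q.length ≤ 18) (hlh : ∀ Q ∈ Qsh, Q.length ≤ 18) (hhexC : ∀ h ∈ hexL, h ∈ C) (hhexxs : ∀ h ∈ hexL, h ∈ xs)
    (hQC : ∀ k, dist (y k) (y i) ≤ r → ∀ Q : List T3,
      ((P k = fccTwoShellPattern ∧ Q ∈ Qsf) ∨ (P k = hcpTwoShellPattern ∧ Q ∈ Qsh)) → Q = C)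
    {j₀ : Fin N} {M₀ : EuclideanSpace ℝ (Fin 3) →ₗᵢ[ℝ] EuclideanSpace ℝ (Fin 3)} {q₀ x₀ : T3} {τs Ds : ℕ → ℝ} {n dm : ℕ}
    (hx₀ : InLayer x₀) (hx₀b : lnorm x₀ ≤ 6 * (n : ℤ))
    (hj₀ : dist (y j₀) (y i) ≤ r) (hE₀ : Estab y A P B i j₀ M₀ C (tadd q₀ x₀) (τs 0) (Ds 0)) (hτmono : Monotone τs) (hDmono : Monotone Ds)
    (hτs : ∀ d : ℕ, d + 1 ≤ dm → τs d + 5 / 2 * (2 * (1 / 10 ^ 4) * ((10011 / 10000 : ℝ) ^ d * nearestDist y j₀) +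
      1 / 10 ^ 4 * ((10011 / 10000 : ℝ) ^ (d + 1) * nearestDist y j₀)) ≤ τs (d + 1))
    (hDs : ∀ d : ℕ, d + 1 ≤ dm → Ds d + 1 / 10 ^ 4 * ((10011 / 10000 : ℝ) ^ d * nearestDist y j₀) + τs d ≤ Ds (d + 1))
    (hroom : ∀ x, InLayer x → lnorm x ≤ 6 * (n : ℤ) → ‖B (mv (tadd q₀ x))‖ + Ds dm ≤ r) :
    ∀ d : ℕ, d ≤ dm → ∀ x : T3, InLayer x → lnorm x ≤ 6 * (n : ℤ) → lnorm (tsub x x₀) ≤ 6 * (d : ℤ) →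
      ∃ k : Fin N, ∃ M : EuclideanSpace ℝ (Fin 3) →ₗᵢ[ℝ] EuclideanSpace ℝ (Fin 3), dist (y k) (y i) ≤ r ∧
        (9967 / 10000 : ℝ) ^ d * nearestDist y j₀ ≤ nearestDist y k ∧ nearestDist y k ≤ (10011 / 10000 : ℝ) ^ d * nearestDist y j₀ ∧
        Estab y A P B i k M C (tadd q₀ x) (τs d) (Ds d) := by
  intro d
  induction d with
  | zero =>
    intro _ x _ _ hl
    have hz : tsub x x₀ = (0, 0, 0) := Summit.AtomisticToContinuum.Crystallization.Theorems.OverbindingBudgetAffineCompressedCutSeed.eq_zero_of_lnorm_le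
      (tsub x x₀) (by simpa using hl)
    have hx0 : x = x₀ := by
      obtain ⟨a, b, c⟩ := x
      obtain ⟨p, q, u⟩ := x₀
      simp only [tsub, Prod.mk.injEq] at hz ⊢
      omega
    subst hx0
    exact ⟨j₀, M₀, hj₀, by simp, by simp, hE₀⟩
  | succ d ih =>
    intro hdn x hx hxb hl
    have hdn' : d ≤ dm := (Nat.le_succ d).trans hdn
    have hΛ1 : (1 : ℝ) ≤ 10011 / 10000 := by norm_num
    have hnn₀ : 0 ≤ nearestDist y j₀ := nearestDist_nonneg y j₀
    by_cases hl' : lnorm (tsub x x₀) ≤ 6 * (d : ℤ)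
    · obtain ⟨k, M, hkr, hlo, hhi, hE⟩ := ih hdn' x hx hxb hl'
      refine ⟨k, M, hkr, ?_, ?_, estab_mono hE (hτmono (Nat.le_succ d)) (hDmono (Nat.le_succ d))⟩
      · have h1 : (9967 / 10000 : ℝ) ^ (d + 1) * nearestDist y j₀ ≤ (9967 / 10000 : ℝ) ^ d * nearestDist y j₀ :=
          mul_le_mul_of_nonneg_right (pow_le_pow_of_le_one (by norm_num) (by norm_num) (Nat.le_succ d)) hnn₀
        exact h1.trans hlo
      · have h1 : (10011 / 10000 : ℝ) ^ d * nearestDist y j₀ ≤ (10011 / 10000 : ℝ) ^ (d + 1) * nearestDist y j₀ :=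
          mul_le_mul_of_nonneg_right (pow_le_pow_right₀ hΛ1 (Nat.le_succ d)) hnn₀
        exact hhi.trans h1
    · have hne : x ≠ x₀ := by
        rintro rfl
        apply hl'
        have h0 : lnorm (tsub x x) = 0 := by
          obtain ⟨a, b, c⟩ := x
          simp [lnorm, tsub]
        rw [h0]
        positivity
      obtain ⟨h, hh, hdesc, hxhb⟩ := ball_descent hx hx₀ hne hxb hx₀b
      have hfacts := hexL_facts h hh
      have hx'L : InLayer (tsub x h) := inLayer_tsub hx hfacts.1
      have hcast : ((d + 1 : ℕ) : ℤ) = (d : ℤ) + 1 := by push_cast; ring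
      have hl'' : lnorm (tsub (tsub x h) x₀) ≤ 6 * (d : ℤ) := by rw [hcast] at hl; linarith
      obtain ⟨p, Mp, hpr, hplo, hphi, hEp⟩ := ih hdn' (tsub x h) hx'L hxhb hl''
      have hroomx := hroom x hx hxb
      have hDn : Ds (d + 1) ≤ Ds dm := hDmono hdn
      have h2p : 1 / 10 ^ 4 * nearestDist y p ≤ 1 / 10 ^ 4 * ((10011 / 10000 : ℝ) ^ d * nearestDist y j₀) :=
        mul_le_mul_of_nonneg_left hphi (by norm_num)
      have hDstep := hDs d hdn
      have hball : ‖B (mv (tadd (tadd q₀ (tsub x h)) h))‖ + (Ds d + 1 / 10 ^ 4 * nearestDist y p + τs d) ≤ r := by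
        rw [tadd_tadd_tsub]
        linarith
      obtain ⟨k, v, -, -, -, -, hkr, hsc, hsc', R₁, -, Q, hQ, hEk⟩ :=
        estab_child_one hy hP hA hf hinj hex hpr hEp (hhexC h hh) hfacts.2 (hhexxs h hh) hKf hKh hlf hlh hball
      have hQC' : Q = C := hQC k hkr Q hQ
      rw [hQC', tadd_tadd_tsub] at hEk
      have hkhi : nearestDist y k ≤ (10011 / 10000 : ℝ) ^ (d + 1) * nearestDist y j₀ := by
        have h1 : 10011 / 10000 * nearestDist y p ≤ 10011 / 10000 * ((10011 / 10000 : ℝ) ^ d * nearestDist y j₀) :=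
          mul_le_mul_of_nonneg_left hphi (by norm_num)
        have e : 10011 / 10000 * ((10011 / 10000 : ℝ) ^ d * nearestDist y j₀) = (10011 / 10000 : ℝ) ^ (d + 1) * nearestDist y j₀ := by
          rw [pow_succ]; ring
        linarith
      have hklo : (9967 / 10000 : ℝ) ^ (d + 1) * nearestDist y j₀ ≤ nearestDist y k := by
        have h1 : 9967 / 10000 * ((9967 / 10000 : ℝ) ^ d * nearestDist y j₀) ≤ 9967 / 10000 * nearestDist y p :=
          mul_le_mul_of_nonneg_left hplo (by norm_num)
        have e : 9967 / 10000 * ((9967 / 10000 : ℝ) ^ d * nearestDist y j₀) = (9967 / 10000 : ℝ) ^ (d + 1) * nearestDist y j₀ := by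
          rw [pow_succ]; ring
        linarith
      refine ⟨k, Mp.comp R₁, hkr, hklo, hkhi, estab_mono hEk ?_ ?_⟩
      · have h1 := hτs d hdn
        have h2 : 2 * (1 / 10 ^ 4) * nearestDist y p ≤ 2 * (1 / 10 ^ 4) * ((10011 / 10000 : ℝ) ^ d * nearestDist y j₀) :=
          mul_le_mul_of_nonneg_left hphi (by norm_num)
        have h3 : 1 / 10 ^ 4 * nearestDist y k ≤ 1 / 10 ^ 4 * ((10011 / 10000 : ℝ) ^ (d + 1) * nearestDist y j₀) :=
          mul_le_mul_of_nonneg_left hkhi (by norm_num)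
        linarith
      · linarith

/-- ★ **The whole ball, uniformly.**  With `2n ≤ dm` every layer point of the hex ball of radius `n` is within hex distance `dm` of the seed, so the
whole ball is established with the top bounds `(τs dm, Ds dm)` and scale window `[0.9967^dm, 1.0011^dm]·nn_{j₀}` — the shape `stack_run` consumes as
its base disc (centre label `q₀`, hex radius `n`). [this file] -/
theorem layer_disc_off_all {y : Fin N → EuclideanSpace ℝ (Fin 3)} (hy : Function.Injective y) {r : ℝ} {i : Fin N}
    {A : Fin N → (EuclideanSpace ℝ (Fin 3) →ₗ[ℝ] EuclideanSpace ℝ (Fin 3))} {Qf : Fin N → (EuclideanSpace ℝ (Fin 3) →ₗᵢ[ℝ] EuclideanSpace ℝ (Fin 3))}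
    {P : Fin N → Finset (EuclideanSpace ℝ (Fin 3))} {f : Fin N → EuclideanSpace ℝ (Fin 3) → EuclideanSpace ℝ (Fin 3)}
    {B : EuclideanSpace ℝ (Fin 3) →ₗ[ℝ] EuclideanSpace ℝ (Fin 3)}
    (hP : ∀ j, dist (y j) (y i) ≤ r → (P j = fccTwoShellPattern ∨ P j = hcpTwoShellPattern))
    (hA : ∀ j, dist (y j) (y i) ≤ r → ∀ v ∈ P j, ‖A j v - Qf j v‖ ≤ 1 / 1000)
    (hf : ∀ j, dist (y j) (y i) ≤ r → ∀ v ∈ P j, f j v ∈ Set.range y ∧ dist (f j v) (y j + nearestDist y j • A j v) ≤ 1 / 10 ^ 4 * nearestDist y j)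
    (hinj : ∀ j, dist (y j) (y i) ≤ r → Set.InjOn (f j) ↑(P j))
    (hex : ∀ j, dist (y j) (y i) ≤ r → ∀ m, m ≠ j → dist (y m) (y j) ≤ (3 / 2 + 1 / 450) * nearestDist y j → ∃ v ∈ P j, f j v = y m)
    {C xs : List T3} {Qsf Qsh : List (List T3)} (hKf : kernelOneB C xs fccL Qsf = true) (hKh : kernelOneB C xs hcpL Qsh = true)
    (hlf : ∀ Q ∈ Qsf, Q.length ≤ 18) (hlh : ∀ Q ∈ Qsh, Q.length ≤ 18) (hhexC : ∀ h ∈ hexL, h ∈ C) (hhexxs : ∀ h ∈ hexL, h ∈ xs)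
    (hQC : ∀ k, dist (y k) (y i) ≤ r → ∀ Q : List T3,
      ((P k = fccTwoShellPattern ∧ Q ∈ Qsf) ∨ (P k = hcpTwoShellPattern ∧ Q ∈ Qsh)) → Q = C)
    {j₀ : Fin N} {M₀ : EuclideanSpace ℝ (Fin 3) →ₗᵢ[ℝ] EuclideanSpace ℝ (Fin 3)} {q₀ x₀ : T3} {τs Ds : ℕ → ℝ} {n dm : ℕ} (hndm : 2 * n ≤ dm)
    (hx₀ : InLayer x₀) (hx₀b : lnorm x₀ ≤ 6 * (n : ℤ))
    (hj₀ : dist (y j₀) (y i) ≤ r) (hE₀ : Estab y A P B i j₀ M₀ C (tadd q₀ x₀) (τs 0) (Ds 0)) (hτmono : Monotone τs) (hDmono : Monotone Ds)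
    (hτs : ∀ d : ℕ, d + 1 ≤ dm → τs d + 5 / 2 * (2 * (1 / 10 ^ 4) * ((10011 / 10000 : ℝ) ^ d * nearestDist y j₀) +
      1 / 10 ^ 4 * ((10011 / 10000 : ℝ) ^ (d + 1) * nearestDist y j₀)) ≤ τs (d + 1))
    (hDs : ∀ d : ℕ, d + 1 ≤ dm → Ds d + 1 / 10 ^ 4 * ((10011 / 10000 : ℝ) ^ d * nearestDist y j₀) + τs d ≤ Ds (d + 1))
    (hroom : ∀ x, InLayer x → lnorm x ≤ 6 * (n : ℤ) → ‖B (mv (tadd q₀ x))‖ + Ds dm ≤ r) :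
    ∀ x : T3, InLayer x → lnorm x ≤ 6 * (n : ℤ) →
      ∃ k : Fin N, ∃ M : EuclideanSpace ℝ (Fin 3) →ₗᵢ[ℝ] EuclideanSpace ℝ (Fin 3), dist (y k) (y i) ≤ r ∧
        (9967 / 10000 : ℝ) ^ dm * nearestDist y j₀ ≤ nearestDist y k ∧ nearestDist y k ≤ (10011 / 10000 : ℝ) ^ dm * nearestDist y j₀ ∧
        Estab y A P B i k M C (tadd q₀ x) (τs dm) (Ds dm) := by
  intro x hx hxb
  have hndmZ : 2 * (n : ℤ) ≤ (dm : ℤ) := by exact_mod_cast hndm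
  have hdist : lnorm (tsub x x₀) ≤ 6 * (dm : ℤ) := by linarith [lnorm_tsub_le x x₀]
  exact layer_disc_off hy hP hA hf hinj hex hKf hKh hlf hlh hhexC hhexxs hQC hx₀ hx₀b hj₀ hE₀ hτmono hDmono hτs hDs hroom dm le_rfl x hx hxb hdist

/-! ## §3  Record instance: an hcp seed anywhere in the disc -/

/-- One-parent tables E1 for an `H`- or `H′`-charted parent: fcc children impossible along basal bonds, hcp children inherit the SAME copy — so the
forcing hypothesis `hQC` of `layer_disc_off` holds with no assumption on the ball. [this file] -/
theorem e1_tables {C : List T3} (hC : C = hcpL ∨ C = hcpAltL) :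
    kernelOneB C hexL fccL [] = true ∧ kernelOneB C hexL hcpL [C] = true ∧ (∀ h ∈ hexL, h ∈ C) := by
  rcases hC with rfl | rfl
  · exact ⟨e1_entries.1, e1_entries.2.1, hexL_sub.1⟩
  · exact ⟨e1_entries.2.2.1, e1_entries.2.2.2, hexL_sub.2.1⟩

/-- ★ **Record instance (Case A base layer).**  A seed `j₀` charted onto `H` or `H′` at label `q₀ + x₀` anywhere in the hex ball of radius `n` about the
centre label `q₀`, ANY base frame `B`: with `2n ≤ dm`, the two step inequalities below `dm` and room `‖B(q₀ + x)‖ + Ds dm ≤ r` on the ball, every layer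
point of the ball is the label of an established site charted onto the SAME copy, bounds `(τs dm, Ds dm)`, scale in `[0.9967^dm, 1.0011^dm]·nn_{j₀}` —
no hypothesis on the types of the other sites. [this file] -/
theorem layer_disc_off_hcp {y : Fin N → EuclideanSpace ℝ (Fin 3)} (hy : Function.Injective y) {r : ℝ} {i : Fin N}
    {A : Fin N → (EuclideanSpace ℝ (Fin 3) →ₗ[ℝ] EuclideanSpace ℝ (Fin 3))} {Qf : Fin N → (EuclideanSpace ℝ (Fin 3) →ₗᵢ[ℝ] EuclideanSpace ℝ (Fin 3))}
    {P : Fin N → Finset (EuclideanSpace ℝ (Fin 3))} {f : Fin N → EuclideanSpace ℝ (Fin 3) → EuclideanSpace ℝ (Fin 3)}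
    {B : EuclideanSpace ℝ (Fin 3) →ₗ[ℝ] EuclideanSpace ℝ (Fin 3)}
    (hP : ∀ j, dist (y j) (y i) ≤ r → (P j = fccTwoShellPattern ∨ P j = hcpTwoShellPattern))
    (hA : ∀ j, dist (y j) (y i) ≤ r → ∀ v ∈ P j, ‖A j v - Qf j v‖ ≤ 1 / 1000)
    (hf : ∀ j, dist (y j) (y i) ≤ r → ∀ v ∈ P j, f j v ∈ Set.range y ∧ dist (f j v) (y j + nearestDist y j • A j v) ≤ 1 / 10 ^ 4 * nearestDist y j)
    (hinj : ∀ j, dist (y j) (y i) ≤ r → Set.InjOn (f j) ↑(P j))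
    (hex : ∀ j, dist (y j) (y i) ≤ r → ∀ m, m ≠ j → dist (y m) (y j) ≤ (3 / 2 + 1 / 450) * nearestDist y j → ∃ v ∈ P j, f j v = y m)
    {C : List T3} (hC : C = hcpL ∨ C = hcpAltL)
    {j₀ : Fin N} {M₀ : EuclideanSpace ℝ (Fin 3) →ₗᵢ[ℝ] EuclideanSpace ℝ (Fin 3)} {q₀ x₀ : T3} {τs Ds : ℕ → ℝ} {n dm : ℕ} (hndm : 2 * n ≤ dm)
    (hx₀ : InLayer x₀) (hx₀b : lnorm x₀ ≤ 6 * (n : ℤ))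
    (hj₀ : dist (y j₀) (y i) ≤ r) (hE₀ : Estab y A P B i j₀ M₀ C (tadd q₀ x₀) (τs 0) (Ds 0)) (hτmono : Monotone τs) (hDmono : Monotone Ds)
    (hτs : ∀ d : ℕ, d + 1 ≤ dm → τs d + 5 / 2 * (2 * (1 / 10 ^ 4) * ((10011 / 10000 : ℝ) ^ d * nearestDist y j₀) +
      1 / 10 ^ 4 * ((10011 / 10000 : ℝ) ^ (d + 1) * nearestDist y j₀)) ≤ τs (d + 1))
    (hDs : ∀ d : ℕ, d + 1 ≤ dm → Ds d + 1 / 10 ^ 4 * ((10011 / 10000 : ℝ) ^ d * nearestDist y j₀) + τs d ≤ Ds (d + 1))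
    (hroom : ∀ x, InLayer x → lnorm x ≤ 6 * (n : ℤ) → ‖B (mv (tadd q₀ x))‖ + Ds dm ≤ r) :
    ∀ x : T3, InLayer x → lnorm x ≤ 6 * (n : ℤ) →
      ∃ k : Fin N, ∃ M : EuclideanSpace ℝ (Fin 3) →ₗᵢ[ℝ] EuclideanSpace ℝ (Fin 3), dist (y k) (y i) ≤ r ∧
        (9967 / 10000 : ℝ) ^ dm * nearestDist y j₀ ≤ nearestDist y k ∧ nearestDist y k ≤ (10011 / 10000 : ℝ) ^ dm * nearestDist y j₀ ∧
        Estab y A P B i k M C (tadd q₀ x) (τs dm) (Ds dm) := by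
  obtain ⟨hKf, hKh, hhexC⟩ := e1_tables hC
  have hQC : ∀ k, dist (y k) (y i) ≤ r → ∀ Q : List T3,
      ((P k = fccTwoShellPattern ∧ Q ∈ ([] : List (List T3))) ∨ (P k = hcpTwoShellPattern ∧ Q ∈ [C])) → Q = C := by
    intro k _ Q hQ
    rcases hQ with ⟨-, hQ⟩ | ⟨-, hQ⟩
    · simp at hQ
    · simpa using hQ
  have hlh : ∀ Q ∈ [C], Q.length ≤ 18 := by
    intro Q hQ
    rw [List.mem_singleton] at hQ
    rw [hQ]
    rcases hC with rfl | rfl <;> decide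
  exact layer_disc_off_all hy hP hA hf hinj hex hKf hKh (by simp) hlh hhexC (fun h hh => hh) hQC hndm hx₀ hx₀b hj₀ hE₀ hτmono hDmono hτs hDs hroom

end Summit.AtomisticToContinuum.Crystallization.Theorems.OverbindingBudgetAffineCompressedCutOffDisc
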